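import Literature.NumberTheory.GaloisCohomology.Howard2004.DVRSettingEngineStub
import Literature.NumberTheory.GaloisCohomology.Howard2004.TowerReductionKernelProofs
import Literature.NumberTheory.GaloisCohomology.Howard2004.PropagateTowerProofs
import Literature.NumberTheory.GaloisCohomology.Howard2004.DVRSettingPiRefinement
import Literature.NumberTheory.GaloisCohomology.Howard2004.DVRSettingLevelTrivialityProofs
import HarnessLib

/-!
# Howard 2004, Lemma 1.6.4 on a `DVRSetting`: the liftability case (the ENGINE's `hlift`) discharged
# (theorems only)

Topic `NumberTheory/GaloisCohomology/Howard2004`; namespace `Literature.NumberTheory.GaloisCohomology.Howard2004`.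
THEOREMS ONLY: no definition, no named fact, no instance, no notation, no `sorry`.  Sequel to
`DVRLevelLiftabilityAtLevelProofs` (LIFT: Lemma 1.6.3 / the liftability step AT LEVEL `n`), `TowerReductionKernelProofs`
(Lemma 1.3.3, kernel form), `TransverseCartesianProofs` (Lemma 1.3.3 at level `n`: ascent/descent of `F(n)`-Selmer
classes along `H¹(inc_{k→k+d})`), `DVRSettingEngineStub` (the ENGINE's data `enginePrimes`, `stubLength`, `stub`) and
`DVRSettingLevelTrivialityProofs` (`Γ_{K_λ}` acts trivially on the levels at `λ ∈ n ∈ 𝓝(𝓛^{(2k-1)})`).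

WHY (INPUTS row G87 = `Howard2004.thm161_dvrKolyvaginBound` = Howard Thm. 1.6.1; stub `stub_h161` of the μ-crux
stmt-BirchSwinnertonDyer-22642; cell `pub/bsd-print-x9`, seat `bsd-line-x10b-p1-w7` g9, brick (ENGINE-hlift)).  The
cell's ENGINE `mem_stub_of_stubLemmaInduction_levels'` (`StubLemmaInductionProofs` / `DVRSettingEngineData`) is
Howard's double induction for Lemma 1.6.4 over ABSTRACT data; its hypothesis

  `hlift : ∀ k n, ↑n ⊆ P k → Stub k n ≠ ⊥ → Stub k n ≠ ⊤ → red k (lam k n) n (κ k n) = 0 → κ k n ∈ Stub k n`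

is the printed first case of the proof (arXiv:1202.6340 p. 11 L85 – p. 12 L9):

> First suppose `Stub^{(k)}(n) ≠ 0`, so that in particular we are in the case `ε = 1`, and `λ^{(k)}(n) < k`.
> Let `i = λ^{(k)}(n)` … `κ^{(i)}_n = 0`.  Appealing again to Lemma (H.5 application), this is equivalent to
> `π^{k-i} κ_n^{(k)} = 0`.  Now by Lemma (liftability), `κ_n^{(k)}` is divisible by `π^i` in
> `H¹_{F(n)}(K, T^{(k)})`, proving this special case.

with Lemma 1.6.3 (p. 11 L69–80) supplying «liftability» from the structure of `H¹_{F(n)}(K, T^{(2k-1)})`: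
«The hypothesis `Stub^{(k)}(n) ≠ 0` implies that `len_R(M^{(2k-1)}) < k`».  This file discharges it on a
`DVRSetting` `S` with H.0–H.5, generically (hence on the full refinement `S.refine`), in the tree's general
exponents `e` (Howard: `e_k = k`, the auxiliary level `2k - 1` = the level of exponent `2e_k - 1`):

* §1 the algebra of «`Stub^{(k)}(n) ≠ 0` implies `len M^{(2k-1)}(n) < k`» WITHOUT a cancellation theorem:
  `pow_smul_eq_zero_of_twin_preimages` — if `ι : C × (M₁ × M₁) →ₗ C₂ × (M₂ × M₂)` hits every `π^{e+1}`-torsion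
  element, `π^e M₁ = 0` and `C` is «uniserial at the top» (`Fin ε → R/𝔪^{e'}`, `ε ≤ 1`, `e' ≤ e + 1`:
  `exists_eq_smul_of_pow_smul_ne_zero`), then `π^{e+1} m = 0 ⟹ π^e m = 0` on `M₂` (test the two twins
  `(0, m, 0)`, `(0, 0, m)`); `pow_smul_eq_zero_of_forall` (downward induction on the exponent);
* §2 **`DVRSetting.pow_smul_eq_zero_twin_of_decompositions`** — Howard's «`M^{(i)} ≅ M^{(k)}[𝔪^i]`» (Lemma 1.3.3 =
  «H.5 application» at level `n`) in the form LIFT consumes: from `R`-equivariant decompositions `θ₁` of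
  `H¹_{F(n)}(K, T^{(k)})` (`ε₁ ≤ 1`, `π^{e_k-1} M₁ = 0`, e.g. `len M₁ < e_k`) and `θ₂` of `H¹_{F(n)}(K, T^{(k+d)})`,
  `π^{e_k-1} M₂ = 0` (the map `ι = θ₂ ∘ H¹(inc_{k→k+d}) ∘ θ₁⁻¹` hits the `π^{e_k}`-torsion by the descent
  `exists_mem_selmerGroup_atLevel_incH1LE_eq`); `…_of_length_lt` (from `len M₁ < e_k`), and the LIFT form
  `π^{e_{k+d}-e_k} M₂ = 0` for `2e_k ≤ e_{k+d} + 1`;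
* §3 the reductions on `H¹`: `AdicTower.cohomologyMap_redLE_eq_redIterH1` (`H¹(redLE) = redIterH1`) and
  **`DVRSetting.cohomologyMap_redLE_eq_zero_iff`** — «`red_{k→i} x = 0 ⟺ π^{e_k-e_i} x = 0`» for the two-index
  reduction `redLE` (Lemma 1.3.3 kernel form `redIterH1_eq_zero_iff`, w7 g8);
* §4 **`DVRSetting.exists_mem_selmerGroup_atLevel_eq_pow_smul_of_redLE_eq_zero`** — THE LIFTABILITY CASE in exponent
  currency: for `c = H¹(red_{k+d→k}) c'` with `c'` an `F(n)`-Selmer class of level `k + d` (structure `θ'` there with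
  `π^{e_{k+d}-e_k} M' = 0`), `H¹(red_{k→i}) c = 0 ⟹ c = π^{e_i} y` with `y ∈ H¹_{F(n)}(K, T^{(k)})`;
* §5 the chosen decomposition behind `stubLength` (`exists_decomposition_stubLength_eq`; the trivial-action
  hypothesis at the primes of `n ∈ 𝓝(𝓛^{(2k-1)})` up to the level of exponent `2e_k - 1` is
  `DVRSettingLevelTrivialityProofs.htriv_of_subset_enginePrimes_of_e_le`), and **`DVRSetting.mem_stub_of_redLE_eq_zero`** — the ENGINE's `hlift` at
  `(k, n)` in its own currency: `x ∈ S.stub hy hdec k n` for an `F(n)`-Selmer class `x` of level `k` that is the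
  reduction of an `F(n)`-Selmer class of the level of exponent `2e_k - 1`, once `H¹(red_{k→i}) x = 0` at the level `i`
  of exponent `λ^{(k)}(n)` — given the Thm. 1.4.2 decomposition at that auxiliary level (hypothesis; the slot
  `HasLevelDecompositionsAt` of the data layer).

HONEST FRAMING: Lemma 1.6.4, Thm. 1.6.1 and `thm161_dvrKolyvaginBound` are NOT proved here (the levelwise structure
Thm. 1.4.2 is an input; the other six hypotheses of the ENGINE are other bricks); no summit statement is proved; the
Birch–Swinnerton-Dyer conjecture is not proved by any of this.
References: [Howard2004HeegnerKolyvagin] Lemma 1.6.3, Lemma 1.6.4 (proof, first case), Lemma 1.3.3, Def. 1.5.4, §1.6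
(arXiv:1202.6340 p. 11 L69–80, p. 11 L85 – p. 12 L9, p. 7 L152–160, p. 10 L56–60, p. 11 L33–38);
[MazurRubinMemoirs2004] Lemma 3.5.4, Prop. 4.5.8.
-/

set_option autoImplicit false

noncomputable section

open Function NumberField IsDedekindDomain Field
open scoped NumberField ContRepresentation

namespace Literature.NumberTheory.GaloisCohomology.Howard2004

open Literature.NumberTheory.GaloisRepresentations
open Literature.NumberTheory.GaloisRepresentations.DiscreteGaloisModule
open Literature.NumberTheory.GaloisRepresentations.galoisCohomology

/-! ## §1 The algebra of «`Stub^{(k)}(n) ≠ 0` implies `len M^{(2k-1)}(n) < k`» -/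

section Algebra

variable {R : Type*} [CommRing R]

/-- **Two twins test the exponent of `M₂`.**  Let `ι : C × (M₁ × M₁) →ₗ[R] C₂ × (M₂ × M₂)` hit every element
killed by `ϖ^{e+1}`, let `ϖ^e` kill `M₁`, and let `C` be «uniserial at the top»: whenever `ϖ^e a ≠ 0`, every `a'`
is a multiple of `a`.  Then `ϖ^{e+1} m = 0 ⟹ ϖ^e m = 0` on `M₂`: the twins `(0, m, 0)` and `(0, 0, m)` have
preimages `y`, `y'` whose `C`-components are not killed by `ϖ^e` (else `ϖ^e m = 0`), so `y' - r y` has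
`C`-component `0` for some `r`, is killed by `ϖ^e`, and so is its image `(0, -r m, m)`.  This is the algebra of
«the hypothesis `Stub^{(k)}(n) ≠ 0` implies that `len_R(M^{(2k-1)}) < k`» (Lemma 1.6.3, proof) read through
Lemma 1.3.3 without a cancellation theorem.
[cite: Howard2004HeegnerKolyvagin, Lemma 1.6.3 proof and Lemma 1.6.4 proof, first case (arXiv:1202.6340 p. 11 L74–80, L85–92: «`M^{(i)} ≅ M^{(k)}[𝔪^i]`»)] -/
theorem pow_smul_eq_zero_of_twin_preimages (ϖ : R) (e : ℕ)
    {C M₁ C₂ M₂ : Type*} [AddCommGroup C] [Module R C] [AddCommGroup M₁] [Module R M₁]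
    [AddCommGroup C₂] [Module R C₂] [AddCommGroup M₂] [Module R M₂]
    (hC : ∀ a a' : C, ϖ ^ e • a ≠ 0 → ∃ r : R, a' = r • a)
    (hM₁ : ∀ m : M₁, ϖ ^ e • m = 0)
    (ι : C × (M₁ × M₁) →ₗ[R] C₂ × (M₂ × M₂))
    (hsurj : ∀ z : C₂ × (M₂ × M₂), ϖ ^ (e + 1) • z = 0 → ∃ y, ι y = z)
    (m₀ : M₂) (hm₀ : ϖ ^ (e + 1) • m₀ = 0) : ϖ ^ e • m₀ = 0 := by
  by_contra h
  obtain ⟨y, hy⟩ := hsurj ((0 : C₂), (m₀, (0 : M₂)))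
    (by rw [Prod.smul_mk, Prod.smul_mk, smul_zero, smul_zero, hm₀]; rfl)
  obtain ⟨y', hy'⟩ := hsurj ((0 : C₂), ((0 : M₂), m₀))
    (by rw [Prod.smul_mk, Prod.smul_mk, smul_zero, smul_zero, hm₀]; rfl)
  -- an element with `C`-component killed by `ϖ^e` is killed by `ϖ^e`, and so is its image
  have key : ∀ w : C × (M₁ × M₁), ϖ ^ e • w.1 = 0 → ϖ ^ e • ι w = 0 := by
    intro w hw
    have hw0 : ϖ ^ e • w = 0 := by
      obtain ⟨a, b, c⟩ := w
      rw [Prod.smul_mk, Prod.smul_mk, hM₁, hM₁]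
      exact Prod.ext hw rfl
    rw [← map_smul, hw0, map_zero]
  -- the `C`-components of the two preimages are not killed by `ϖ^e`
  have ha : ϖ ^ e • y.1 ≠ 0 := by
    intro h0
    have h1 := key y h0
    rw [hy] at h1
    exact h (by simpa using congrArg (fun z : C₂ × (M₂ × M₂) => z.2.1) h1)
  obtain ⟨r, hr⟩ := hC y.1 y'.1 ha
  have hw : ϖ ^ e • (y' - r • y).1 = 0 := by
    rw [Prod.fst_sub, Prod.smul_fst, hr, sub_self, smul_zero]
  have h2 := key (y' - r • y) hw
  rw [map_sub, map_smul, hy, hy'] at h2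
  exact h (by simpa using congrArg (fun z : C₂ × (M₂ × M₂) => z.2.2) h2)

/-- **`R^{(k),ε} = (Fin ε → R/𝔪^{e'})` with `ε ≤ 1` is «uniserial at the top»**: if `π^e a ≠ 0` with `e' ≤ e + 1`
(so `ε = 1` and `a ∉ 𝔪 R^{(k)}`, i.e. `a` is a unit multiple of `1`), every `a'` is a multiple of `a` (`R` local,
`π ∈ 𝔪`). [cite: Howard2004HeegnerKolyvagin, Lemma 1.6.3 proof (arXiv p. 11 L78–80: «the image is isomorphic to `𝔪^{k-1}R^{(2k-1)} ≅ R^{(k)}`») and §1.6 (p. 11 L33–35: `R^{(k)} = R/𝔪^k`)] -/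
theorem exists_eq_smul_of_pow_smul_ne_zero [IsLocalRing R] {π : R}
    (hπ : π ∈ IsLocalRing.maximalIdeal R) {ε : ℕ} (hε : ε ≤ 1) {e e' : ℕ} (he : e' ≤ e + 1)
    (a a' : Fin ε → R ⧸ IsLocalRing.maximalIdeal R ^ e') (ha : π ^ e • a ≠ 0) :
    ∃ r : R, a' = r • a := by
  rcases Nat.le_one_iff_eq_zero_or_eq_one.mp hε with rfl | rfl
  · exact absurd (Subsingleton.elim _ _) ha
  · obtain ⟨s, hs⟩ := Ideal.Quotient.mk_surjective (a 0)
    obtain ⟨s', hs'⟩ := Ideal.Quotient.mk_surjective (a' 0)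
    have hsu : IsUnit s := by
      by_contra hns
      have hsm : s ∈ IsLocalRing.maximalIdeal R := hns
      apply ha
      funext i
      obtain rfl : i = 0 := Subsingleton.elim _ _
      rw [Pi.smul_apply, Pi.zero_apply, ← hs, Algebra.smul_def, Ideal.Quotient.algebraMap_eq, ← map_mul,
        Ideal.Quotient.eq_zero_iff_mem]
      have h1 : π ^ e * s ∈ IsLocalRing.maximalIdeal R ^ e * IsLocalRing.maximalIdeal R :=
        Ideal.mul_mem_mul (Ideal.pow_mem_pow hπ _) hsm
      rw [← pow_succ] at h1
      exact Ideal.pow_le_pow_right he h1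
    obtain ⟨u, hu⟩ := hsu
    refine ⟨s' * ↑u⁻¹, funext fun i => ?_⟩
    obtain rfl : i = 0 := Subsingleton.elim _ _
    rw [Pi.smul_apply, ← hs, ← hs', Algebra.smul_def, Ideal.Quotient.algebraMap_eq, ← map_mul, mul_assoc, ← hu,
      Units.inv_mul, mul_one]

/-- Downward induction on the exponent: if `ϖ^{e+1} m = 0 ⟹ ϖ^e m = 0` for every `m`, then
`ϖ^{e+t} m = 0 ⟹ ϖ^e m = 0`. [cite: Howard2004HeegnerKolyvagin, Lemma 1.6.3 proof (arXiv p. 11 L78–80)] -/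
theorem pow_smul_eq_zero_of_forall (ϖ : R) (e : ℕ) {M : Type*} [AddCommGroup M] [Module R M]
    (h : ∀ m : M, ϖ ^ (e + 1) • m = 0 → ϖ ^ e • m = 0) :
    ∀ (t : ℕ) (m : M), ϖ ^ (e + t) • m = 0 → ϖ ^ e • m = 0
  | 0, m, hm => by rwa [Nat.add_zero] at hm
  | t + 1, m, hm => by
    have h1 : ϖ ^ (e + 1) • (ϖ ^ t • m) = 0 := by
      rw [← mul_smul, ← pow_add, show e + 1 + t = e + (t + 1) by omega, hm]
    have h2 := h _ h1
    rw [← mul_smul, ← pow_add] at h2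
    exact pow_smul_eq_zero_of_forall ϖ e h t m h2

end Algebra

/-! ## §2 «`M^{(i)} ≅ M^{(k)}[𝔪^i]`» in LIFT's form: the exponent of `M^{(k+d)}(n)` from a decomposition at level `k` -/

namespace DVRSetting

variable {p : ℕ} [Fact p.Prime] {K : Type} [Field K] [NumberField K]
  {R : Type} [CommRing R] [IsDomain R] [IsDiscreteValuationRing R] [Algebra ℤ_[p] R]
  {N : ℕ → Type} [∀ k, AddCommGroup (N k)] [∀ k, TopologicalSpace (N k)]
  [∀ k, DiscreteTopology (N k)] [∀ k, Module R (N k)]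
  {Rk : ℕ → Type} [∀ k, CommRing (Rk k)] [∀ k, IsLocalRing (Rk k)] [∀ k, TopologicalSpace (Rk k)]
  [∀ k, DiscreteTopology (Rk k)] [∀ k, Algebra ℤ_[p] (Rk k)] [∀ k, Algebra R (Rk k)]
  [∀ k, Module (Rk k) (N k)] [∀ k, IsScalarTower R (Rk k) (N k)]
  {Nbar : Type} [AddCommGroup Nbar] [TopologicalSpace Nbar] [DiscreteTopology Nbar]
  [∀ k, Module (Rk k) Nbar]
  {Nq : ℕ → Finset (HeightOneSpectrum (𝓞 K)) → Type} [∀ k n, AddCommGroup (Nq k n)]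
  [∀ k n, TopologicalSpace (Nq k n)] [∀ k n, DiscreteTopology (Nq k n)]
  [∀ k n, Module (Rk k) (Nq k n)] [∀ k n, Module R (Nq k n)]
  [∀ k n, IsScalarTower R (Rk k) (Nq k n)]

/-- **Howard's «`M^{(i)} ≅ M^{(k)}[𝔪^i]`» (Lemma 1.3.3 = «Lemma (H.5 application)» at level `n`) in the form the
liftability step consumes.**  On a `DVRSetting` with H.0–H.5, levels `k ≤ k + d`, `n` a finite set of primes whose
transverse fixers act trivially on the levels `≤ k + d` (print: `n ∈ 𝓝^{(k+d)}`): given additive `R`-equivariant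
decompositions `θ₁ : H¹_{F(n)}(K, T^{(k)}) ≃ (Fin ε₁ → R/𝔪^{e_k}) × (M₁ × M₁)` with `ε₁ ≤ 1` and `π^{e_k-1} M₁ = 0`
(i.e. `λ^{(k)}(n) = len M₁ < e_k`, «`Stub^{(k)}(n) ≠ 0`») and `θ₂ : H¹_{F(n)}(K, T^{(k+d)}) ≃ (Fin ε₂ → R/𝔪^{e_{k+d}}) ×
(M₂ × M₂)` (Thm. 1.4.2 at the two levels), `π^{e_k-1}` kills `M₂` — «the hypothesis `Stub^{(k)}(n) ≠ 0` implies that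
`len_R(M^{(2k-1)}) < k`».  Proof: the `R`-linear `ι = θ₂ ∘ H¹(inc_{k→k+d}) ∘ θ₁⁻¹` hits every `π^{e_k}`-torsion element
(Lemma 1.3.3 at level `n`: `exists_mem_selmerGroup_atLevel_incH1LE_eq`), and §1 (`pow_smul_eq_zero_of_twin_preimages`,
then downward induction from `π^{e_{k+d}} M₂ = 0`).
[cite: Howard2004HeegnerKolyvagin, Lemma 1.6.3 proof and Lemma 1.6.4 proof, first case (arXiv:1202.6340 p. 11 L74–80, L85–92); Lemma 1.3.3 (p. 7 L152–160)]
[cite: MazurRubinMemoirs2004, Lemma 3.5.4] -/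
theorem pow_smul_eq_zero_twin_of_decompositions (S : DVRSetting p K R N Rk Nbar Nq) (hy : S.SatisfiesH)
    (n : Finset (HeightOneSpectrum (𝓞 K))) (k d : ℕ)
    (htriv : ∀ j, j ≤ k + d → ∀ w ∈ n, ∀ g ∈ transverseFixer p (residueChar w) S.jbar w, ∀ y : N j,
      GaloisRep.toLocal w (S.T.ρ j) g y = y)
    {ε₁ : ℕ} (hε₁ : ε₁ ≤ 1) {M₁ : Type} [AddCommGroup M₁] [Module R M₁]
    (θ₁ : ↥((((S.t k).atLevel S.jbar n).cond).selmerGroup) ≃+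
      ((Fin ε₁ → R ⧸ IsLocalRing.maximalIdeal R ^ S.e k) × (M₁ × M₁)))
    (hθ₁ : ∀ (r : R) (y : galoisCohomology (S.T.ρ k) 1)
      (hy' : y ∈ (((S.t k).atLevel S.jbar n).cond).selmerGroup),
      θ₁ ⟨scalarMapH1 (S.T.ρ k) (S.T.hlin k) r y, S.scalarMapH1_mem_selmerGroup_atLevel hy k n r hy'⟩ =
        r • θ₁ ⟨y, hy'⟩)
    (hM₁ : ∀ m : M₁, S.π ^ (S.e k - 1) • m = 0)
    {ε₂ : ℕ} {M₂ : Type} [AddCommGroup M₂] [Module R M₂]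
    (θ₂ : ↥((((S.t (k + d)).atLevel S.jbar n).cond).selmerGroup) ≃+
      ((Fin ε₂ → R ⧸ IsLocalRing.maximalIdeal R ^ S.e (k + d)) × (M₂ × M₂)))
    (hθ₂ : ∀ (r : R) (y : galoisCohomology (S.T.ρ (k + d)) 1)
      (hy' : y ∈ (((S.t (k + d)).atLevel S.jbar n).cond).selmerGroup),
      θ₂ ⟨scalarMapH1 (S.T.ρ (k + d)) (S.T.hlin (k + d)) r y,
          S.scalarMapH1_mem_selmerGroup_atLevel hy (k + d) n r hy'⟩ = r • θ₂ ⟨y, hy'⟩) :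
    ∀ m : M₂, S.π ^ (S.e k - 1) • m = 0 := by
  have hπm : S.π ∈ IsLocalRing.maximalIdeal R := S.pi_mem_maximalIdeal hy
  have hle : ∀ j, S.e j ≤ S.e (j + 1) := S.e_le_succ hy
  have he1 : 1 ≤ S.e k := hy.e_zero.trans_le (hy.e_strictMono.monotone (Nat.zero_le k))
  -- `H¹(inc_{k→k+d})` maps `F(n)`-Selmer classes to `F(n)`-Selmer classes and commutes with the scalars
  have hinc : ∀ y ∈ (((S.t k).atLevel S.jbar n).cond).selmerGroup,
      AdicTower.incH1LE S.T S.π S.e hy.killed hy.ker_red hπm hle k (k + d) (Nat.le_add_right k d) y ∈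
        (((S.t (k + d)).atLevel S.jbar n).cond).selmerGroup := fun y hy' =>
    (S.incH1LE_mem_selmerGroup_atLevel_iff hy hπm hle n (k + d) htriv k d le_rfl y).2 hy'
  have hincsm : ∀ (r : R) (y : galoisCohomology (S.T.ρ k) 1),
      AdicTower.incH1LE S.T S.π S.e hy.killed hy.ker_red hπm hle k (k + d) (Nat.le_add_right k d)
          (scalarMapH1 (S.T.ρ k) (S.T.hlin k) r y) =
        scalarMapH1 (S.T.ρ (k + d)) (S.T.hlin (k + d)) r
          (AdicTower.incH1LE S.T S.π S.e hy.killed hy.ker_red hπm hle k (k + d) (Nat.le_add_right k d) y) :=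
    fun r y => (DFunLike.congr_fun (AdicTower.scalarMapH1_comp_incH1LE S.T S.π S.e hy.killed hy.ker_red hπm hle r
      k (k + d) (Nat.le_add_right k d)) y).symm
  -- `θ₁⁻¹` commutes with the scalars
  have symm_smul : ∀ (r : R) (x : (Fin ε₁ → R ⧸ IsLocalRing.maximalIdeal R ^ S.e k) × (M₁ × M₁)),
      ((θ₁.symm (r • x) : ↥((((S.t k).atLevel S.jbar n).cond).selmerGroup)) : galoisCohomology (S.T.ρ k) 1) =
        scalarMapH1 (S.T.ρ k) (S.T.hlin k) r
          ((θ₁.symm x : ↥((((S.t k).atLevel S.jbar n).cond).selmerGroup)) : galoisCohomology (S.T.ρ k) 1) := by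
    intro r x
    have h := hθ₁ r (θ₁.symm x).1 (θ₁.symm x).2
    rw [Subtype.coe_eta, AddEquiv.apply_symm_apply] at h
    have h2 := congrArg θ₁.symm h
    rw [AddEquiv.symm_apply_apply] at h2
    exact (congrArg Subtype.val h2).symm
  -- the comparison map `ι = θ₂ ∘ H¹(inc) ∘ θ₁⁻¹`, `R`-linear between genuine `R`-modules
  let ι : ((Fin ε₁ → R ⧸ IsLocalRing.maximalIdeal R ^ S.e k) × (M₁ × M₁)) →ₗ[R]
      ((Fin ε₂ → R ⧸ IsLocalRing.maximalIdeal R ^ S.e (k + d)) × (M₂ × M₂)) :=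
    { toFun := fun x => θ₂ ⟨AdicTower.incH1LE S.T S.π S.e hy.killed hy.ker_red hπm hle k (k + d)
          (Nat.le_add_right k d) ((θ₁.symm x : ↥((((S.t k).atLevel S.jbar n).cond).selmerGroup)) : _),
        hinc _ (θ₁.symm x).2⟩
      map_add' := fun x y => by
        rw [← map_add θ₂]
        congr 1
        apply Subtype.ext
        change AdicTower.incH1LE S.T S.π S.e hy.killed hy.ker_red hπm hle k (k + d) (Nat.le_add_right k d)
            ((θ₁.symm (x + y) : ↥((((S.t k).atLevel S.jbar n).cond).selmerGroup)) : _) = _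
        rw [map_add θ₁.symm, AddSubgroup.coe_add, map_add]
        rfl
      map_smul' := fun r x => by
        rw [RingHom.id_apply, ← hθ₂ r _ (hinc _ (θ₁.symm x).2)]
        congr 1
        apply Subtype.ext
        change AdicTower.incH1LE S.T S.π S.e hy.killed hy.ker_red hπm hle k (k + d) (Nat.le_add_right k d)
            ((θ₁.symm (r • x) : ↥((((S.t k).atLevel S.jbar n).cond).selmerGroup)) : _) = _
        rw [symm_smul, hincsm] }
  -- `ι` hits every `π^{e_k}`-torsion element (Lemma 1.3.3 at level `n`, descent)
  have hsurj : ∀ z : (Fin ε₂ → R ⧸ IsLocalRing.maximalIdeal R ^ S.e (k + d)) × (M₂ × M₂),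
      S.π ^ (S.e k - 1 + 1) • z = 0 → ∃ x, ι x = z := by
    intro z hz
    rw [Nat.sub_add_cancel he1] at hz
    have hc0 : scalarMapH1 (S.T.ρ (k + d)) (S.T.hlin (k + d)) (S.π ^ S.e k)
        ((θ₂.symm z : ↥((((S.t (k + d)).atLevel S.jbar n).cond).selmerGroup)) : _) = 0 := by
      have h := hθ₂ (S.π ^ S.e k) (θ₂.symm z).1 (θ₂.symm z).2
      rw [Subtype.coe_eta, AddEquiv.apply_symm_apply, hz] at h
      exact congrArg Subtype.val ((map_eq_zero_iff θ₂ θ₂.injective).1 h)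
    obtain ⟨c₀, hc₀, hc₀c⟩ := S.exists_mem_selmerGroup_atLevel_incH1LE_eq hy hπm hle n (k + d) htriv k d le_rfl
      _ (θ₂.symm z).2 hc0
    refine ⟨θ₁ ⟨c₀, hc₀⟩, ?_⟩
    change θ₂ ⟨AdicTower.incH1LE S.T S.π S.e hy.killed hy.ker_red hπm hle k (k + d) (Nat.le_add_right k d)
        ((θ₁.symm (θ₁ ⟨c₀, hc₀⟩) : ↥((((S.t k).atLevel S.jbar n).cond).selmerGroup)) : _), _⟩ = z
    have h1 : (⟨AdicTower.incH1LE S.T S.π S.e hy.killed hy.ker_red hπm hle k (k + d) (Nat.le_add_right k d)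
        ((θ₁.symm (θ₁ ⟨c₀, hc₀⟩) : ↥((((S.t k).atLevel S.jbar n).cond).selmerGroup)) : _),
        hinc _ (θ₁.symm (θ₁ ⟨c₀, hc₀⟩)).2⟩ : ↥((((S.t (k + d)).atLevel S.jbar n).cond).selmerGroup)) =
        θ₂.symm z := by
      apply Subtype.ext
      change AdicTower.incH1LE S.T S.π S.e hy.killed hy.ker_red hπm hle k (k + d) (Nat.le_add_right k d)
        ((θ₁.symm (θ₁ ⟨c₀, hc₀⟩) : ↥((((S.t k).atLevel S.jbar n).cond).selmerGroup)) : _) = _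
      rw [AddEquiv.symm_apply_apply]
      exact hc₀c
    rw [h1]
    exact θ₂.apply_symm_apply z
  -- every element of the target is killed by `π^{e_{k+d}}`
  have hkill : ∀ z : (Fin ε₂ → R ⧸ IsLocalRing.maximalIdeal R ^ S.e (k + d)) × (M₂ × M₂),
      S.π ^ S.e (k + d) • z = 0 := by
    intro z
    have h := hθ₂ (S.π ^ S.e (k + d)) (θ₂.symm z).1 (θ₂.symm z).2
    rw [Subtype.coe_eta, AddEquiv.apply_symm_apply] at h
    rw [← h]
    have hz : (⟨scalarMapH1 (S.T.ρ (k + d)) (S.T.hlin (k + d)) (S.π ^ S.e (k + d))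
        ((θ₂.symm z : ↥((((S.t (k + d)).atLevel S.jbar n).cond).selmerGroup)) : _),
        S.scalarMapH1_mem_selmerGroup_atLevel hy (k + d) n _ (θ₂.symm z).2⟩ :
          ↥((((S.t (k + d)).atLevel S.jbar n).cond).selmerGroup)) = 0 :=
      Subtype.ext (S.scalarMapH1_pow_eq_zero_of_le hy (k + d) le_rfl _)
    rw [hz, map_zero]
  -- §1: `π^{e_k} m = 0 ⟹ π^{e_k-1} m = 0`, then downward induction from `π^{e_{k+d}} m = 0`
  have step : ∀ m : M₂, S.π ^ (S.e k - 1 + 1) • m = 0 → S.π ^ (S.e k - 1) • m = 0 :=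
    pow_smul_eq_zero_of_twin_preimages S.π (S.e k - 1)
      (fun a a' ha => exists_eq_smul_of_pow_smul_ne_zero hπm hε₁ (e := S.e k - 1) (e' := S.e k) (by omega)
        a a' ha) hM₁ ι hsurj
  have hd : S.e k - 1 ≤ S.e (k + d) := by
    have := hy.e_strictMono.monotone (Nat.le_add_right k d); omega
  obtain ⟨t, ht⟩ := Nat.exists_eq_add_of_le hd
  intro m
  refine pow_smul_eq_zero_of_forall S.π (S.e k - 1) step t m ?_
  rw [← ht]
  simpa using congrArg (fun z : (Fin ε₂ → R ⧸ IsLocalRing.maximalIdeal R ^ S.e (k + d)) × (M₂ × M₂) => z.2.1)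
    (hkill ((0 : Fin ε₂ → R ⧸ IsLocalRing.maximalIdeal R ^ S.e (k + d)), (m, (0 : M₂))))

end DVRSetting

/-! ## §3 The two-index reductions on `H¹`: `H¹(redLE) = redIterH1`, and Lemma 1.3.3 (kernel form) for `redLE` -/

namespace AdicTower

variable {K : Type} [Field K] [NumberField K] {R : Type} [CommRing R] [IsLocalRing R]
  {N : ℕ → Type} [∀ k, AddCommGroup (N k)] [∀ k, TopologicalSpace (N k)] [∀ k, DiscreteTopology (N k)]
  [∀ k, Module R (N k)]

omit [NumberField K] in
/-- `H¹` of the two-index reduction `redLE (k ≤ k + d)` is the iterated reduction `redIterH1 k d` on classes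
(`redLE_eq_redIter` pointwise, `H¹` of pointwise-equal maps agree). [cite: Howard2004HeegnerKolyvagin, §1.6 (arXiv p. 12, L29–33)] -/
theorem cohomologyMap_redLE_eq_redIterH1 (T : AdicTower K R N) (k d : ℕ) (c : galoisCohomology (T.ρ (k + d)) 1) :
    ContinuousRep.cohomologyMap (T.ρ (k + d)) (T.ρ k) (T.redLE (Nat.le_add_right k d)).toAddMonoidHom
        continuous_of_discreteTopology (T.redLE_equivariant (Nat.le_add_right k d)) 1 c =
      T.redIterH1 k d c :=
  cohomologyMap_one_congr_apply (T.ρ (k + d)) (T.ρ k) (T.redLE (Nat.le_add_right k d)).toAddMonoidHom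
    (T.redIter k d).toAddMonoidHom (T.redLE_equivariant (Nat.le_add_right k d)) (T.redIter_equivariant k d)
    (fun x => T.redLE_eq_redIter k d x) c

end AdicTower

namespace DVRSetting

variable {p : ℕ} [Fact p.Prime] {K : Type} [Field K] [NumberField K]
  {R : Type} [CommRing R] [IsDomain R] [IsDiscreteValuationRing R] [Algebra ℤ_[p] R]
  {N : ℕ → Type} [∀ k, AddCommGroup (N k)] [∀ k, TopologicalSpace (N k)]
  [∀ k, DiscreteTopology (N k)] [∀ k, Module R (N k)]
  {Rk : ℕ → Type} [∀ k, CommRing (Rk k)] [∀ k, IsLocalRing (Rk k)] [∀ k, TopologicalSpace (Rk k)]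
  [∀ k, DiscreteTopology (Rk k)] [∀ k, Algebra ℤ_[p] (Rk k)] [∀ k, Algebra R (Rk k)]
  [∀ k, Module (Rk k) (N k)] [∀ k, IsScalarTower R (Rk k) (N k)]
  {Nbar : Type} [AddCommGroup Nbar] [TopologicalSpace Nbar] [DiscreteTopology Nbar]
  [∀ k, Module (Rk k) Nbar]
  {Nq : ℕ → Finset (HeightOneSpectrum (𝓞 K)) → Type} [∀ k n, AddCommGroup (Nq k n)]
  [∀ k n, TopologicalSpace (Nq k n)] [∀ k n, DiscreteTopology (Nq k n)]
  [∀ k n, Module (Rk k) (Nq k n)] [∀ k n, Module R (Nq k n)]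
  [∀ k n, IsScalarTower R (Rk k) (Nq k n)]

/-- **Lemma 1.3.3, kernel form, for the two-index reduction: `H¹(red_{k→i}) c = 0 ↔ π^{e_k-e_i} c = 0`** for
every class `c ∈ H¹(K, T^{(k)})` of a `DVRSetting` with H.0–H.5 and `i ≤ k` — «Appealing again to Lemma (H.5
application), this [`κ^{(i)}_n = 0`] is equivalent to `π^{k-i} κ_n^{(k)} = 0`» (`redIterH1_eq_zero_iff` after §3's
identification). [cite: Howard2004HeegnerKolyvagin, Lemma 1.3.3 and Lemma 1.6.4 proof, first case (arXiv p. 7 L152–160, p. 11 L90 – p. 12 L1)] -/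
theorem cohomologyMap_redLE_eq_zero_iff (S : DVRSetting p K R N Rk Nbar Nq) (hy : S.SatisfiesH) {i k : ℕ}
    (h : i ≤ k) (c : galoisCohomology (S.T.ρ k) 1) :
    ContinuousRep.cohomologyMap (S.T.ρ k) (S.T.ρ i) (S.T.redLE h).toAddMonoidHom continuous_of_discreteTopology
        (S.T.redLE_equivariant h) 1 c = 0 ↔
      scalarMapH1 (S.T.ρ k) (S.T.hlin k) (S.π ^ (S.e k - S.e i)) c = 0 := by
  obtain ⟨D, rfl⟩ := Nat.exists_eq_add_of_le h
  rw [AdicTower.cohomologyMap_redLE_eq_redIterH1]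
  exact S.redIterH1_eq_zero_iff hy i D c

/-! ## §4 The liftability case in exponent currency -/

/-- **Howard 2004, Lemma 1.6.4, first case («liftability»), on a `DVRSetting` with H.0–H.5, in exponent currency.**
Levels `i ≤ k ≤ k + d`; `n` a finite set of primes whose transverse fixers act trivially on the levels `≤ k + d`
(print: `n ∈ 𝓝^{(2k-1)}`); the printed structure `θ' : H¹_{F(n)}(K, T^{(k+d)}) ≃ (Fin ε → R/𝔪^{e_{k+d}}) × (M' × M')`
(Thm. 1.4.2 at `(k + d, n)`, additive `R`-equivariant) with `π^{e_{k+d}-e_k} M' = 0` (§2).  If `c = H¹(red_{k+d→k}) c'`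
for an `F(n)`-Selmer class `c'` of level `k + d` (for the Kolyvagin classes: `κ^{(k)}_n = red κ^{(k+d)}_n`) and
`H¹(red_{k→i}) c = 0` («`κ^{(i)}_n = 0`»), then `c = π^{e_i} y` for an `F(n)`-SELMER class `y ∈ H¹_{F(n)}(K, T^{(k)})`
(«`κ_n^{(k)}` is divisible by `π^i` in `H¹_{F(n)}(K, T^{(k)})`»).  Proof: §3 turns the hypothesis into
`π^{e_k-e_i} c = 0`, `H¹(inc_{k→k+d}) c = π^{e_{k+d}-e_k} c'` (`incH1LE_redIterH1_eq_scalarMapH1_pow`), and LIFT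
(`exists_mem_selmerGroup_atLevel_eq_scalarMapH1_pow_of_incH1LE_eq`, `j = e_k - e_i`).
[cite: Howard2004HeegnerKolyvagin, Lemma 1.6.4 proof, first case, with Lemma 1.6.3 and Lemma 1.3.3 (arXiv:1202.6340 p. 11 L85 – p. 12 L9; p. 11 L69–80; p. 7 L152–160)]
[cite: MazurRubinMemoirs2004, Lemma 3.5.4 and Prop. 4.5.8] -/
theorem exists_mem_selmerGroup_atLevel_eq_pow_smul_of_redLE_eq_zero (S : DVRSetting p K R N Rk Nbar Nq)
    (hy : S.SatisfiesH) (n : Finset (HeightOneSpectrum (𝓞 K))) (k d : ℕ)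
    (htriv : ∀ j, j ≤ k + d → ∀ w ∈ n, ∀ g ∈ transverseFixer p (residueChar w) S.jbar w, ∀ y : N j,
      GaloisRep.toLocal w (S.T.ρ j) g y = y)
    {ε : ℕ} {M' : Type} [AddCommGroup M'] [Module R M']
    (θ' : ↥((((S.t (k + d)).atLevel S.jbar n).cond).selmerGroup) ≃+
      ((Fin ε → R ⧸ IsLocalRing.maximalIdeal R ^ S.e (k + d)) × (M' × M')))
    (hθ' : ∀ (r : R) (y : galoisCohomology (S.T.ρ (k + d)) 1)
      (hy' : y ∈ (((S.t (k + d)).atLevel S.jbar n).cond).selmerGroup),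
      θ' ⟨scalarMapH1 (S.T.ρ (k + d)) (S.T.hlin (k + d)) r y,
          S.scalarMapH1_mem_selmerGroup_atLevel hy (k + d) n r hy'⟩ = r • θ' ⟨y, hy'⟩)
    (hM' : ∀ m : M', S.π ^ (S.e (k + d) - S.e k) • m = 0)
    {c' : galoisCohomology (S.T.ρ (k + d)) 1} (hc' : c' ∈ (((S.t (k + d)).atLevel S.jbar n).cond).selmerGroup)
    {c : galoisCohomology (S.T.ρ k) 1}
    (hcc' : c = ContinuousRep.cohomologyMap (S.T.ρ (k + d)) (S.T.ρ k) (S.T.redLE (Nat.le_add_right k d)).toAddMonoidHom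
      continuous_of_discreteTopology (S.T.redLE_equivariant (Nat.le_add_right k d)) 1 c')
    {i : ℕ} (hik : i ≤ k)
    (h0 : ContinuousRep.cohomologyMap (S.T.ρ k) (S.T.ρ i) (S.T.redLE hik).toAddMonoidHom
      continuous_of_discreteTopology (S.T.redLE_equivariant hik) 1 c = 0) :
    ∃ y ∈ (((S.t k).atLevel S.jbar n).cond).selmerGroup, c = scalarMapH1 (S.T.ρ k) (S.T.hlin k) (S.π ^ S.e i) y := by
  have hπm : S.π ∈ IsLocalRing.maximalIdeal R := S.pi_mem_maximalIdeal hy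
  have hle : ∀ j, S.e j ≤ S.e (j + 1) := S.e_le_succ hy
  have hik' : S.e i ≤ S.e k := hy.e_strictMono.monotone hik
  -- «this is equivalent to `π^{k-i} κ_n^{(k)} = 0`»
  rw [S.cohomologyMap_redLE_eq_zero_iff hy hik] at h0
  -- `c` is the reduction of `c'`, read through Lemma 1.3.3's `H¹(inc_{k→k+d})`
  have hcc : AdicTower.incH1LE S.T S.π S.e hy.killed hy.ker_red hπm hle k (k + d) (Nat.le_add_right k d) c =
      scalarMapH1 (S.T.ρ (k + d)) (S.T.hlin (k + d)) (S.π ^ (S.e (k + d) - S.e k)) c' := by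
    rw [hcc', AdicTower.cohomologyMap_redLE_eq_redIterH1]
    exact AdicTower.incH1LE_redIterH1_eq_scalarMapH1_pow S.T S.π S.e hy.killed hy.ker_red hπm hle k d c'
  -- «Now by Lemma (liftability), `κ_n^{(k)}` is divisible by `π^i`»
  obtain ⟨y, hysel, hy_eq⟩ := S.exists_mem_selmerGroup_atLevel_eq_scalarMapH1_pow_of_incH1LE_eq hy hπm hle n k d
    htriv θ' hθ' hM' hc' hcc (Nat.sub_le (S.e k) (S.e i)) h0
  refine ⟨y, hysel, ?_⟩
  rwa [Nat.sub_sub_self hik'] at hy_eq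

/-! ## §5 The ENGINE's `hlift` at `(k, n)` in its own currency -/

/-- **The chosen decomposition behind `λ^{(k)}(n)`**: for `n ∈ 𝓝(𝓛^{(2k-1)})`, `stubLength` is the length of the
`M` of SOME decomposition of the hypothesis `HasLevelDecompositions` at `(k, n)` (the one it chose).
[cite: Howard2004HeegnerKolyvagin, Def. 1.5.4 (arXiv Def. 2.5.4, p. 10 L56–58)] -/
theorem exists_decomposition_stubLength_eq (S : DVRSetting p K R N Rk Nbar Nq) (hy : S.SatisfiesH)
    (hdec : S.HasLevelDecompositions hy) (k : ℕ) {n : Finset (HeightOneSpectrum (𝓞 K))}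
    (hn : ↑n ⊆ S.enginePrimes k) :
    ∃ (ε : ℕ) (_ : ε ≤ 1) (M : Type) (_ : AddCommGroup M) (_ : Module R M) (_ : Finite M)
      (θ : ↥((((S.t k).atLevel S.jbar n).cond).selmerGroup) ≃+
        ((Fin ε → R ⧸ IsLocalRing.maximalIdeal R ^ S.e k) × (M × M))),
      (∀ (r : R) (y : galoisCohomology (S.T.ρ k) 1) (hy' : y ∈ (((S.t k).atLevel S.jbar n).cond).selmerGroup),
        θ ⟨scalarMapH1 (S.T.ρ k) (S.T.hlin k) r y, S.scalarMapH1_mem_selmerGroup_atLevel hy k n r hy'⟩ =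
          r • θ ⟨y, hy'⟩) ∧
      S.stubLength hy hdec k n = (Module.length R M).toNat := by
  have h1 := Classical.choose_spec (hdec k n hn)
  have h2 := Classical.choose_spec h1
  have h3 := Classical.choose_spec h2
  have h4 := Classical.choose_spec h3
  have h5 := Classical.choose_spec h4
  have h6 := Classical.choose_spec h5
  refine ⟨_, Classical.choose h1, _, Classical.choose h3, Classical.choose h4, Classical.choose h5,
    Classical.choose h6, Classical.choose_spec h6, ?_⟩
  simp only [stubLength, dif_pos hn]

/-- **The ENGINE's `hlift` at `(k, n)`, discharged in its own currency.**  On a `DVRSetting` with H.0–H.5 and the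
levelwise structure (`hdec`, feeding `stubLength` / `stub`), let `n ∈ 𝓝(𝓛^{(2k-1)})`, let `k + d` be the auxiliary
level of exponent `2e_k - 1` (Howard's `T^{(2k-1)}`; on the full refinement `d = k`) with ITS decomposition `θ'`
(Thm. 1.4.2 at `(k + d, n)` — the slot `HasLevelDecompositionsAt` at `levelPrimes (k + d) ⊇ enginePrimes k`), let `x` be an
`F(n)`-Selmer class of level `k` that is the reduction of an `F(n)`-Selmer class of level `k + d` (the Kolyvagin class
`κ^{(k)}_n = red κ^{(2k-1)}_n`), and let `i ≤ k` be the level of exponent `λ^{(k)}(n)` (Howard's `i = λ^{(k)}(n)`;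
`Stub^{(k)}(n) ≠ 0, ≠ H` place it in range).  If `H¹(red_{k→i}) x = 0` («`κ^{(i)}_n = 0`») then
`x ∈ Stub^{(k)}(n) = 𝔪^{λ^{(k)}(n)} H¹_{F(n)}(K, T^{(k)})`.  (If `λ^{(k)}(n) = e_k` then `i = k` and `x = 0`; else §2 gives
`π^{e_{k+d}-e_k} M' = 0` from `len M^{(k)}(n) < e_k`, and §4 applies.)
[cite: Howard2004HeegnerKolyvagin, Lemma 1.6.4 proof, first case (arXiv:1202.6340 p. 11 L85 – p. 12 L9), Lemma 1.6.3 (p. 11 L69–80), Def. 1.5.4 (p. 10 L56–60)]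
[cite: MazurRubinMemoirs2004, Prop. 4.5.8] -/
theorem mem_stub_of_redLE_eq_zero (S : DVRSetting p K R N Rk Nbar Nq) (hy : S.SatisfiesH)
    (hdec : S.HasLevelDecompositions hy) (k d : ℕ) (hd : S.e (k + d) + 1 = 2 * S.e k)
    {n : Finset (HeightOneSpectrum (𝓞 K))} (hn : ↑n ⊆ S.enginePrimes k)
    {ε' : ℕ} {M' : Type} [AddCommGroup M'] [Module R M']
    (θ' : ↥((((S.t (k + d)).atLevel S.jbar n).cond).selmerGroup) ≃+
      ((Fin ε' → R ⧸ IsLocalRing.maximalIdeal R ^ S.e (k + d)) × (M' × M')))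
    (hθ' : ∀ (r : R) (y : galoisCohomology (S.T.ρ (k + d)) 1)
      (hy' : y ∈ (((S.t (k + d)).atLevel S.jbar n).cond).selmerGroup),
      θ' ⟨scalarMapH1 (S.T.ρ (k + d)) (S.T.hlin (k + d)) r y,
          S.scalarMapH1_mem_selmerGroup_atLevel hy (k + d) n r hy'⟩ = r • θ' ⟨y, hy'⟩)
    {x : galoisCohomology (S.T.ρ k) 1} (hx : x ∈ (((S.t k).atLevel S.jbar n).cond).selmerGroup)
    {c' : galoisCohomology (S.T.ρ (k + d)) 1} (hc' : c' ∈ (((S.t (k + d)).atLevel S.jbar n).cond).selmerGroup)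
    (hxc' : x = ContinuousRep.cohomologyMap (S.T.ρ (k + d)) (S.T.ρ k) (S.T.redLE (Nat.le_add_right k d)).toAddMonoidHom
      continuous_of_discreteTopology (S.T.redLE_equivariant (Nat.le_add_right k d)) 1 c')
    {i : ℕ} (hik : i ≤ k) (hei : S.e i = S.stubLength hy hdec k n)
    (h0 : ContinuousRep.cohomologyMap (S.T.ρ k) (S.T.ρ i) (S.T.redLE hik).toAddMonoidHom
      continuous_of_discreteTopology (S.T.redLE_equivariant hik) 1 x = 0) :
    letI := galoisCohomology.moduleH1 (S.T.ρ k) (S.T.hlin k)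
    (⟨x, hx⟩ : ↥(S.selmerModuleAt hy k n)) ∈ S.stub hy hdec k n := by
  letI := galoisCohomology.moduleH1 (S.T.ρ k) (S.T.hlin k)
  obtain ⟨ε₁, hε₁, M₁, _, _, _, θ₁, hθ₁, hlen⟩ := S.exists_decomposition_stubLength_eq hy hdec k hn
  rw [S.mem_stub_iff hy hdec k n]
  rcases (hy.e_strictMono.monotone hik).eq_or_lt with heq | hlt
  · -- `λ^{(k)}(n) = e_k`: then `i = k`, `red_{k→k} = id` and `x = 0`
    have hik' : i = k := hy.e_strictMono.injective heq
    subst hik'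
    have hx0 : x = 0 := by
      have hid : ContinuousRep.cohomologyMap (S.T.ρ i) (S.T.ρ i) (S.T.redLE hik).toAddMonoidHom
          continuous_of_discreteTopology (S.T.redLE_equivariant hik) 1 x = x :=
        cohomologyMap_one_id_apply (S.T.ρ i) (S.T.redLE hik).toAddMonoidHom (S.T.redLE_equivariant hik)
          (fun z => S.T.redLE_self i z) x
      rw [hid] at h0
      exact h0
    refine ⟨0, ?_⟩
    rw [smul_zero]
    exact (Subtype.ext hx0 : (⟨x, hx⟩ : ↥(S.selmerModuleAt hy i n)) = 0).symm
  · -- `λ^{(k)}(n) < e_k`: `π^{e_k - 1} M^{(k)}(n) = 0`, §2 at the auxiliary level, §4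
    have htriv := S.htriv_of_subset_enginePrimes_of_e_le hy (show S.e (k + d) ≤ 2 * S.e k - 1 by omega) hn
    have hM₁ : ∀ m : M₁, S.π ^ (S.e k - 1) • m = 0 := by
      intro m
      haveI : IsArtinian R M₁ := isArtinian_of_finite
      have hmem : S.π ^ (S.e k - 1) ∈ IsLocalRing.maximalIdeal R ^ (Module.length R M₁).toNat := by
        have hle' : (Module.length R M₁).toNat ≤ S.e k - 1 := by rw [← hlen, ← hei]; omega
        exact Ideal.pow_le_pow_right hle' (Ideal.pow_mem_pow (S.pi_mem_maximalIdeal hy) _)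
      exact smul_eq_zero_of_mem_maximalIdeal_pow_length hmem m
    have hM' := S.pow_smul_eq_zero_twin_of_decompositions hy n k d htriv hε₁ θ₁ hθ₁ hM₁ θ' hθ'
    have hM'' : ∀ m : M', S.π ^ (S.e (k + d) - S.e k) • m = 0 := by
      intro m
      obtain ⟨t, ht⟩ := Nat.exists_eq_add_of_le (show S.e k - 1 ≤ S.e (k + d) - S.e k by omega)
      rw [ht, pow_add, mul_comm, mul_smul, hM' m, smul_zero]
    obtain ⟨y, hysel, hyeq⟩ := S.exists_mem_selmerGroup_atLevel_eq_pow_smul_of_redLE_eq_zero hy n k d htriv θ' hθ'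
      hM'' hc' hxc' hik h0
    refine ⟨⟨y, hysel⟩, Subtype.ext ?_⟩
    rw [← hei]
    exact hyeq.symm

end DVRSetting

end Literature.NumberTheory.GaloisCohomology.Howard2004

end
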